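import Summits.AnomalousDissipation.AnomalousDissipation.Theorems.SolenoidalFractalHomogenisationLagrangianStepSidebandSkewFrame
import Summits.AnomalousDissipation.AnomalousDissipation.Theorems.SolenoidalFractalHomogenisationLagrangianStepSidebandSlotDefsFrame
import Summits.AnomalousDissipation.AnomalousDissipation.Theorems.SolenoidalFractalHomogenisationLagrangianStepSidebandSlot
import HarnessLib

/-!
# K1L_D `LagrangianRenormalisationStepDesign` (stmt-AnomalousDissipation-27980), registered stub `stub_D1_V0thg` (v28, ruling D28-3 (3)), port-map layer L4:
# the FROZEN-FRAME own-slot algebra of the twisted truncated sideband generator (helper; `--supports stmt-AnomalousDissipation-27980 --as helper`)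

Summits-side helper file of route `SolenoidalFractalHomogenisation` (prover seat `ad-k1l-cellLawV-w1` g9; port map
`Cruxes/LagrangianRenormalisationStepDesign/Lines/onelevel-vtheta-twist-portmap.md` §3 L4, ruling D28-7).  The frozen-frame twin of `…SidebandSlot`:
the constant frame `G₀` twists only the fibre projections (`P_z ↦ P^θ_z = transversalProjR (twistFreq G₀ z)`) and the symbol (`𝔸 ↦ 𝔸^{G₀} = Visc4.conj G₀ 𝔸`);
the link coefficients, the single-fibre states `injL`, the feedback functionals and every TIME structure are flat and REUSED BY NAME from `…SidebandSlot`
(`linkCoeff_eq_zero_of_ladder`, `links_invisible_of_slot`, `linkCoeff_eq_zero_of_slot`, `m_ne_neg_m`, `coordL_coe_apply`, `feedback_injL_*`).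
Everything proved; no definitions, no named facts, no sorry.
* **`genθ_injL`** — a link-invisible fibre `m` is `genθ(t)`-invariant and carries the twisted block dynamics `blockGenθ 𝔸 G₀ γ₁ m`; during slot `j` this is the
  case at `m = ±mⱼ` (`genθ_injL_self / _neg`);
* `sourceθ_eq_injL`, `coordL_sourceθ_self / _neg` — the twisted unit source is the two-fibre state with `P^θ_{±mⱼ} v`;
* `apply_genθ_of_slot`, `coordL_genθ_of_slot`, `hasDerivAt_coordL_of_slot_frame` — THE OWN FIBRE IS CLOSED DURING ITS SLOT: the own-fibre amplitude of any
  solution of `y' = sourceθⱼ v + genθ y` solves the closed fibre ODE `u' = (source)_{mⱼ} + blockGenθ u`;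
* **`norm_le_exp_of_hasDerivAt_genθ`** — under the frame hypothesis `c |k|² ≤ |G₀ᵀk|²` (`0 ≤ c`), every orbit of `u' = genθ(t) u` contracts at the rate
  `min(γ₁, 4π² lo' c)` (energy identity + `real_inner_genθ_le` of `…SidebandSkewFrame`); `norm_le_of_hasDerivAt_genθ` the rate-free form.
At `G₀ = 1` every statement is literally its flat twin (`genθ_one`, `sourceθ_one`, `blockGenθ_one`).
NOT a proof of any registered stub, of the crux, or of anomalous dissipation; rung F-D1 infrastructure for the `stub_D1_V0thg` engine (layers L5–L7 use it).
-/

set_option linter.dupNamespace false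

noncomputable section

namespace Summit.AnomalousDissipation.AnomalousDissipation.Theorems.SolenoidalFractalHomogenisation.LagrangianStep.Sideband

open Set MeasureTheory Complex
open scoped InnerProductSpace
open Literature.Analysis Literature.Analysis.FunctionSpaces Literature.Analysis.FunctionSpaces.Torus
open Literature.Analysis.FluidPDE Literature.Analysis.FluidPDE.Torus Literature.Analysis.FluidPDE.LatticeShear
open Summit.AnomalousDissipation.AnomalousDissipation.Theorems.SolenoidalFractalHomogenisation.LagrangianStep.CellChain (linkCoeff)

variable {k₀ : ℕ}

/-! ## §1 Link-invisible fibres are invariant under the twisted generator and carry the twisted block dynamics -/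

/-- **INVARIANCE OF A LINK-INVISIBLE FIBRE.**  If every link that would read the fibre `m` vanishes at time `t` (`linkCoeff_{j'}(z') = 0` whenever
`z' − m_{j'} = m` or `z' + m_{j'} = m`), then the single-fibre state `injL R m u` is mapped by `gen(t)` to the single-fibre state carrying the block
dynamics: `gen t (injL R m u) = injL R m (blockGenθ 𝔸 G₀ γ₁ m u)`. [cite: MajdaKramer1999, §2.2.1.3 (cell problem (49))] -/
theorem genθ_injL (W₁ : LatticeWord k₀) (𝔸 : Torus.Visc4 (Fin 3)) (G₀ : Matrix (Fin 3) (Fin 3) ℝ) (γ₁ : ℝ) {R : ℕ} {t : ℝ} {m : Fin 3 → ℤ} (hm : m ∈ box R)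
    (hlink : ∀ (j' : Fin k₀) (z' : box R), (z'.1 - (W₁.phase j').m = m ∨ z'.1 + (W₁.phase j').m = m) → linkCoeff W₁ 1 z'.1 j' t = 0)
    (u : EuclideanSpace ℂ (Fin 3)) :
    genθ W₁ 𝔸 G₀ γ₁ R t (injL R m u) = injL R m (blockGenθ 𝔸 G₀ γ₁ m u) := by
  ext z' : 1
  rw [genθ_apply, genCompθ_apply, injL_apply]
  have hlinks : ∑ j, linkCoeff W₁ 1 z'.1 j t • transversalProjR (twistFreq G₀ z'.1)
      (slotAmp W₁ j • transversalProjR (twistFreq G₀ (z'.1 - (W₁.phase j).m)) (coordL R (z'.1 - (W₁.phase j).m) (injL R m u)) +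
        starRingEnd ℂ (slotAmp W₁ j) • transversalProjR (twistFreq G₀ (z'.1 + (W₁.phase j).m)) (coordL R (z'.1 + (W₁.phase j).m) (injL R m u))) = 0 := by
    refine Finset.sum_eq_zero fun j _ => ?_
    by_cases h : z'.1 - (W₁.phase j).m = m ∨ z'.1 + (W₁.phase j).m = m
    · rw [hlink j z' h, zero_smul]
    · rw [not_or] at h
      rw [coordL_injL_of_ne h.1, coordL_injL_of_ne h.2]
      simp
  rw [hlinks, sub_zero]
  by_cases hz : (z' : Fin 3 → ℤ) = m
  · rw [if_pos hz, hz, coordL_injL_self hm, blockGenθ_apply]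
  · rw [if_neg hz, coordL_injL_of_ne hz]
    simp

/-- **Own-slot block dynamics on the fibre `mⱼ`.** [cite: MajdaKramer1999, §2.2.1.3 (cell problem (49))] -/
theorem genθ_injL_self (W₁ : LatticeWord k₀) (𝔸 : Torus.Visc4 (Fin 3)) (G₀ : Matrix (Fin 3) (Fin 3) ℝ) (γ₁ : ℝ) {R : ℕ} (j : Fin k₀) {t : ℝ}
    (hoff : ∀ j', j' ≠ j → slotEnvelope W₁ j' t = 0) (hm : (W₁.phase j).m ∈ box R) (u : EuclideanSpace ℂ (Fin 3)) :
    genθ W₁ 𝔸 G₀ γ₁ R t (injL R (W₁.phase j).m u) = injL R (W₁.phase j).m (blockGenθ 𝔸 G₀ γ₁ (W₁.phase j).m u) :=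
  genθ_injL W₁ 𝔸 G₀ γ₁ hm (links_invisible_of_slot W₁ j hoff (Or.inl rfl)) u

/-- **Own-slot block dynamics on the fibre `−mⱼ`.** [cite: MajdaKramer1999, §2.2.1.3 (cell problem (49))] -/
theorem genθ_injL_neg (W₁ : LatticeWord k₀) (𝔸 : Torus.Visc4 (Fin 3)) (G₀ : Matrix (Fin 3) (Fin 3) ℝ) (γ₁ : ℝ) {R : ℕ} (j : Fin k₀) {t : ℝ}
    (hoff : ∀ j', j' ≠ j → slotEnvelope W₁ j' t = 0) (hm : -(W₁.phase j).m ∈ box R) (u : EuclideanSpace ℂ (Fin 3)) :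
    genθ W₁ 𝔸 G₀ γ₁ R t (injL R (-(W₁.phase j).m) u) = injL R (-(W₁.phase j).m) (blockGenθ 𝔸 G₀ γ₁ (-(W₁.phase j).m) u) :=
  genθ_injL W₁ 𝔸 G₀ γ₁ hm (links_invisible_of_slot W₁ j hoff (Or.inr rfl)) u

/-! ## §2 Twisted source on fibres; the own fibre is closed during its slot -/

/-- **The unit source of slot `j` is a two-fibre state**: `sourceⱼ(t) v = injL mⱼ (−2πi envⱼ αⱼ • P_{mⱼ} v) + injL (−mⱼ) (−2πi envⱼ ᾱⱼ • P_{−mⱼ} v)`.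
[cite: MajdaKramer1999, §2.2.1.3 (cell problem (49), source term)] -/
theorem sourceθ_eq_injL (W₁ : LatticeWord k₀) (G₀ : Matrix (Fin 3) (Fin 3) ℝ) (R : ℕ) (j : Fin k₀) (t : ℝ) (v : EuclideanSpace ℂ (Fin 3)) :
    sourceθ W₁ G₀ R j t v =
      injL R (W₁.phase j).m ((-(2 * Real.pi * Complex.I * ((slotEnvelope W₁ j t : ℝ) : ℂ) * slotAmp W₁ j)) • transversalProjR (twistFreq G₀ (W₁.phase j).m) v) +
      injL R (-(W₁.phase j).m) ((-(2 * Real.pi * Complex.I * ((slotEnvelope W₁ j t : ℝ) : ℂ) * starRingEnd ℂ (slotAmp W₁ j))) •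
        transversalProjR (twistFreq G₀ (-(W₁.phase j).m)) v) := by
  ext z' : 1
  rw [sourceθ_apply, PiLp.add_apply, injL_apply, injL_apply, sourceCompθ, add_apply]
  congr 1
  · split_ifs with h
    · rw [smul_apply, h]
    · rfl
  · split_ifs with h
    · rw [smul_apply, h]
    · rfl

/-- A fibre into which no link feeds carries the block dynamics: if `linkCoeff_{j'}(z) = 0` for all `j'`, then `(gen t y)_z = blockGenθ 𝔸 G₀ γ₁ z (y_z)` for
every state `y`. [cite: MajdaKramer1999, §2.2.1.3 (cell problem (49))] -/
theorem genCompθ_eq_blockGenθ (W₁ : LatticeWord k₀) (𝔸 : Torus.Visc4 (Fin 3)) (G₀ : Matrix (Fin 3) (Fin 3) ℝ) (γ₁ : ℝ) {R : ℕ} {t : ℝ} (z : box R)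
    (hl : ∀ j' : Fin k₀, linkCoeff W₁ 1 z.1 j' t = 0) (y : Space R) :
    genCompθ W₁ 𝔸 G₀ γ₁ R t z y = blockGenθ 𝔸 G₀ γ₁ z.1 (coordL R z.1 y) := by
  rw [genCompθ_apply, blockGenθ_apply]
  simp only [hl, zero_smul, Finset.sum_const_zero, sub_zero]

/-- **THE OWN FIBRE IS CLOSED DURING ITS SLOT** (subtype form): for a retained `z` with `z = ±mⱼ` and all other envelopes off at `t`,
`(gen t y) z = blockGenθ 𝔸 G₀ γ₁ z (y z)` for EVERY state `y`. [cite: MajdaKramer1999, §2.2.1.3 (cell problem (49))] -/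
theorem apply_genθ_of_slot (W₁ : LatticeWord k₀) (𝔸 : Torus.Visc4 (Fin 3)) (G₀ : Matrix (Fin 3) (Fin 3) ℝ) (γ₁ : ℝ) {R : ℕ} (j : Fin k₀) {t : ℝ}
    (hoff : ∀ j', j' ≠ j → slotEnvelope W₁ j' t = 0) (z : box R) (hm : z.1 = (W₁.phase j).m ∨ z.1 = -(W₁.phase j).m) (y : Space R) :
    genθ W₁ 𝔸 G₀ γ₁ R t y z = blockGenθ 𝔸 G₀ γ₁ z.1 (y z) := by
  rw [genθ_apply, genCompθ_eq_blockGenθ W₁ 𝔸 G₀ γ₁ z (linkCoeff_eq_zero_of_slot W₁ j hoff hm) y, coordL_coe_apply]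

/-- **THE OWN FIBRE IS CLOSED DURING ITS SLOT.**  If the envelopes of all other slots vanish at `t`, nobody feeds INTO the fibre `mⱼ`: for EVERY state
`y`, `(gen t y)_{mⱼ} = blockGenθ 𝔸 G₀ γ₁ mⱼ (y_{mⱼ})` read through `coordL` (the links at `z = mⱼ` carry the factor `êⱼ·mⱼ = 0`; the other slots are off);
the same at `−mⱼ`.  Hence the amplitude `t ↦ (N t v)_{±mⱼ}` of ANY solution of `y' = sourceⱼ v + gen y` solves a closed linear ODE on `ℂ³` during
slot `j`. [cite: MajdaKramer1999, §2.2.1.3 (cell problem (49))] [cite: MeshalkinSinai1961, pp. 1700–1705] -/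
theorem coordL_genθ_of_slot (W₁ : LatticeWord k₀) (𝔸 : Torus.Visc4 (Fin 3)) (G₀ : Matrix (Fin 3) (Fin 3) ℝ) (γ₁ : ℝ) (R : ℕ) (j : Fin k₀) {t : ℝ}
    (hoff : ∀ j', j' ≠ j → slotEnvelope W₁ j' t = 0) {m : Fin 3 → ℤ} (hm : m = (W₁.phase j).m ∨ m = -(W₁.phase j).m) (y : Space R) :
    coordL R m (genθ W₁ 𝔸 G₀ γ₁ R t y) = blockGenθ 𝔸 G₀ γ₁ m (coordL R m y) := by
  by_cases hmb : m ∈ box R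
  · obtain ⟨z, rfl⟩ : ∃ z : box R, (z : Fin 3 → ℤ) = m := ⟨⟨m, hmb⟩, rfl⟩
    rw [coordL_coe_apply, coordL_coe_apply]
    exact apply_genθ_of_slot W₁ 𝔸 G₀ γ₁ j hoff z hm y
  · rw [coordL_apply_of_not_mem hmb, coordL_apply_of_not_mem hmb, map_zero]

/-- The own-fibre amplitude of a solution of `y' = sourceⱼ(t) v + gen(t) y` solves, during slot `j`, the CLOSED fibre equation
`u' = −2πi envⱼ αⱼ • P_{mⱼ} v + blockGen u` (read through `coordL`; at `−mⱼ` with `ᾱⱼ`). [cite: MajdaKramer1999, §2.2.1.3 (cell problem (49))] -/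
theorem hasDerivAt_coordL_of_slot_frame (W₁ : LatticeWord k₀) (𝔸 : Torus.Visc4 (Fin 3)) (G₀ : Matrix (Fin 3) (Fin 3) ℝ) (γ₁ : ℝ) (R : ℕ) (j : Fin k₀) {t : ℝ}
    (hoff : ∀ j', j' ≠ j → slotEnvelope W₁ j' t = 0) {m : Fin 3 → ℤ} (hm : m = (W₁.phase j).m ∨ m = -(W₁.phase j).m)
    {Y : ℝ → Space R} {v : EuclideanSpace ℂ (Fin 3)}
    (hY : HasDerivAt Y (sourceθ W₁ G₀ R j t v + ((genθ W₁ 𝔸 G₀ γ₁ R t).restrictScalars ℝ) (Y t)) t) :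
    HasDerivAt (fun s => coordL R m (Y s)) (coordL R m (sourceθ W₁ G₀ R j t v) + blockGenθ 𝔸 G₀ γ₁ m (coordL R m (Y t))) t := by
  have h := ((coordL R m).restrictScalars ℝ).hasFDerivAt.comp_hasDerivAt t hY
  have he : ((coordL R m).restrictScalars ℝ) (sourceθ W₁ G₀ R j t v + ((genθ W₁ 𝔸 G₀ γ₁ R t).restrictScalars ℝ) (Y t)) =
      coordL R m (sourceθ W₁ G₀ R j t v) + blockGenθ 𝔸 G₀ γ₁ m (coordL R m (Y t)) := by
    rw [ContinuousLinearMap.coe_restrictScalars', map_add, ContinuousLinearMap.coe_restrictScalars', coordL_genθ_of_slot W₁ 𝔸 G₀ γ₁ R j hoff hm]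
  rw [he] at h
  exact h

/-- The source read on the fibre `mⱼ`. [cite: MajdaKramer1999, §2.2.1.3 (cell problem (49), source term)] -/
theorem coordL_sourceθ_self (W₁ : LatticeWord k₀) (G₀ : Matrix (Fin 3) (Fin 3) ℝ) {R : ℕ} (j : Fin k₀) (t : ℝ) (hm : (W₁.phase j).m ∈ box R) (v : EuclideanSpace ℂ (Fin 3)) :
    coordL R (W₁.phase j).m (sourceθ W₁ G₀ R j t v) =
      (-(2 * Real.pi * Complex.I * ((slotEnvelope W₁ j t : ℝ) : ℂ) * slotAmp W₁ j)) • transversalProjR (twistFreq G₀ (W₁.phase j).m) v := by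
  rw [coordL_apply_of_mem hm, sourceθ_apply]
  show sourceCompθ W₁ G₀ R j t ⟨(W₁.phase j).m, hm⟩ v = _
  rw [sourceCompθ, add_apply, if_pos rfl, if_neg (m_ne_neg_m W₁ j), smul_apply, zero_apply, add_zero]

/-- The source read on the fibre `−mⱼ`. [cite: MajdaKramer1999, §2.2.1.3 (cell problem (49), source term)] -/
theorem coordL_sourceθ_neg (W₁ : LatticeWord k₀) (G₀ : Matrix (Fin 3) (Fin 3) ℝ) {R : ℕ} (j : Fin k₀) (t : ℝ) (hm : -(W₁.phase j).m ∈ box R) (v : EuclideanSpace ℂ (Fin 3)) :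
    coordL R (-(W₁.phase j).m) (sourceθ W₁ G₀ R j t v) =
      (-(2 * Real.pi * Complex.I * ((slotEnvelope W₁ j t : ℝ) : ℂ) * starRingEnd ℂ (slotAmp W₁ j))) • transversalProjR (twistFreq G₀ (-(W₁.phase j).m)) v := by
  rw [coordL_apply_of_mem hm, sourceθ_apply]
  show sourceCompθ W₁ G₀ R j t ⟨-(W₁.phase j).m, hm⟩ v = _
  rw [sourceCompθ, add_apply, if_neg (Ne.symm (m_ne_neg_m W₁ j)), if_pos rfl, smul_apply, zero_apply, zero_add]

/-! ## §3 Contraction of homogeneous orbits of the twisted generator -/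

/-- **CONTRACTION OF HOMOGENEOUS ORBITS.**  For `NearIso 𝔸 lo' hi'`, `lo' ≥ 0`: every solution of `u' = gen(t) u` on `[t₀, t₁]` satisfies
`‖u t₁‖ ≤ e^{−min(γ₁, 4π²lo')(t₁ − t₀)} ‖u t₀‖` (energy identity + `real_inner_gen_le`). [cite: SandersVerhulstMurdock2007, Lemma 5.2.7 (linear case)] -/
theorem norm_le_exp_of_hasDerivAt_genθ (W₁ : LatticeWord k₀) {𝔸 : Torus.Visc4 (Fin 3)} {lo' hi' : ℝ}
    (h𝔸 : Torus.NearIso 𝔸 lo' hi') (hlo' : 0 ≤ lo')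
    (G₀ : Matrix (Fin 3) (Fin 3) ℝ) {c : ℝ} (hc0 : 0 ≤ c) (hG : ∀ k : Fin 3 → ℤ, c * freqNormSq k ≤ ∑ a, twistFreq G₀ k a ^ 2) (γ₁ : ℝ) (R : ℕ) {u : ℝ → Space R} {t₀ t₁ : ℝ} (h01 : t₀ ≤ t₁)
    (hderiv : ∀ t ∈ Icc t₀ t₁, HasDerivAt u (((genθ W₁ 𝔸 G₀ γ₁ R t).restrictScalars ℝ) (u t)) t) :
    ‖u t₁‖ ≤ Real.exp (-(min γ₁ (4 * Real.pi ^ 2 * (lo' * c)) * (t₁ - t₀))) * ‖u t₀‖ := by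
  set r := min γ₁ (4 * Real.pi ^ 2 * (lo' * c)) with hr
  -- energy `ψ = e^{2rt}‖u‖²` is non-increasing
  set ψ : ℝ → ℝ := fun t => Real.exp (2 * r * t) * ‖u t‖ ^ 2 with hψ
  have hψd : ∀ t ∈ Icc t₀ t₁, HasDerivAt ψ (Real.exp (2 * r * t) * (2 * r) * ‖u t‖ ^ 2
      + Real.exp (2 * r * t) * (2 * ⟪u t, ((genθ W₁ 𝔸 G₀ γ₁ R t).restrictScalars ℝ) (u t)⟫_ℝ)) t := by
    intro t ht
    have h1 : HasDerivAt (fun s => Real.exp (2 * r * s)) (Real.exp (2 * r * t) * (2 * r)) t := by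
      simpa using ((hasDerivAt_id t).const_mul (2 * r)).exp
    have h2 : HasDerivAt (fun s => ‖u s‖ ^ 2) (2 * ⟪u t, ((genθ W₁ 𝔸 G₀ γ₁ R t).restrictScalars ℝ) (u t)⟫_ℝ) t := by
      have h := (hderiv t ht).norm_sq
      simpa using h
    exact h1.mul h2
  have hψle : ∀ t ∈ Icc t₀ t₁, Real.exp (2 * r * t) * (2 * r) * ‖u t‖ ^ 2
      + Real.exp (2 * r * t) * (2 * ⟪u t, ((genθ W₁ 𝔸 G₀ γ₁ R t).restrictScalars ℝ) (u t)⟫_ℝ) ≤ 0 := by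
    intro t _
    have hg := real_inner_genθ_le W₁ h𝔸 hlo' G₀ hc0 hG γ₁ R t (u t)
    rw [real_inner_comm] at hg
    have he : 0 < Real.exp (2 * r * t) := Real.exp_pos _
    have : ⟪u t, ((genθ W₁ 𝔸 G₀ γ₁ R t).restrictScalars ℝ) (u t)⟫_ℝ ≤ -r * ‖u t‖ ^ 2 := by
      simpa [hr] using hg
    nlinarith
  have hanti : AntitoneOn ψ (Icc t₀ t₁) := by
    refine antitoneOn_of_deriv_nonpos (convex_Icc t₀ t₁) ?_ ?_ ?_
    · exact fun t ht => (hψd t ht).continuousAt.continuousWithinAt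
    · intro t ht
      rw [interior_Icc] at ht
      exact (hψd t ⟨ht.1.le, ht.2.le⟩).differentiableAt.differentiableWithinAt
    · intro t ht
      rw [interior_Icc] at ht
      rw [(hψd t ⟨ht.1.le, ht.2.le⟩).deriv]
      exact hψle t ⟨ht.1.le, ht.2.le⟩
  have hmono := hanti (left_mem_Icc.2 h01) (right_mem_Icc.2 h01) h01
  simp only [hψ] at hmono
  have hsq : ‖u t₁‖ ^ 2 ≤ (Real.exp (-(r * (t₁ - t₀))) * ‖u t₀‖) ^ 2 := by
    rw [mul_pow, ← Real.exp_nat_mul]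
    have hexp : Real.exp (↑(2:ℕ) * -(r * (t₁ - t₀))) * Real.exp (2 * r * t₁) = Real.exp (2 * r * t₀) := by
      rw [← Real.exp_add]; congr 1; push_cast; ring
    have := mul_le_mul_of_nonneg_left hmono (Real.exp_pos (↑(2:ℕ) * -(r * (t₁ - t₀)))).le
    rw [← mul_assoc, ← mul_assoc, hexp] at this
    have he1 : 0 < Real.exp (2 * r * t₀) := Real.exp_pos _
    nlinarith [this]
  have hnn : 0 ≤ Real.exp (-(r * (t₁ - t₀))) * ‖u t₀‖ := by positivity
  exact (abs_le_of_sq_le_sq' hsq hnn).2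

/-- **Contraction without rate** (the case used for the own-slot difference): `‖u t₁‖ ≤ ‖u t₀‖` when `γ₁ ≥ 0`. [cite: SandersVerhulstMurdock2007, Lemma 5.2.7] -/
theorem norm_le_of_hasDerivAt_genθ (W₁ : LatticeWord k₀) {𝔸 : Torus.Visc4 (Fin 3)} {lo' hi' : ℝ}
    (h𝔸 : Torus.NearIso 𝔸 lo' hi') (hlo' : 0 ≤ lo')
    (G₀ : Matrix (Fin 3) (Fin 3) ℝ) {c : ℝ} (hc0 : 0 ≤ c) (hG : ∀ k : Fin 3 → ℤ, c * freqNormSq k ≤ ∑ a, twistFreq G₀ k a ^ 2) {γ₁ : ℝ} (hγ₁ : 0 ≤ γ₁) (R : ℕ) {u : ℝ → Space R} {t₀ t₁ : ℝ} (h01 : t₀ ≤ t₁)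
    (hderiv : ∀ t ∈ Icc t₀ t₁, HasDerivAt u (((genθ W₁ 𝔸 G₀ γ₁ R t).restrictScalars ℝ) (u t)) t) :
    ‖u t₁‖ ≤ ‖u t₀‖ := by
  have h := norm_le_exp_of_hasDerivAt_genθ W₁ h𝔸 hlo' G₀ hc0 hG γ₁ R h01 hderiv
  have hr : 0 ≤ min γ₁ (4 * Real.pi ^ 2 * (lo' * c)) := le_min hγ₁ (by positivity)
  have he : Real.exp (-(min γ₁ (4 * Real.pi ^ 2 * (lo' * c)) * (t₁ - t₀))) ≤ 1 := by
    rw [Real.exp_le_one_iff]; nlinarith [sub_nonneg.2 h01]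
  exact h.trans ((mul_le_of_le_one_left (norm_nonneg _) he))

end Summit.AnomalousDissipation.AnomalousDissipation.Theorems.SolenoidalFractalHomogenisation.LagrangianStep.Sideband

end
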